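import Mathlib
import HarnessLib
import HarnessLib.Audit
import Summits.AnomalousDissipation.Statement
import Literature.Analysis.FluidPDE.ClassicalSolution

/-!
Route: SteadySweep

CLOSED (retired) 2026-08-15T13:38:20Z by operator:999:1257524 — reason: not-a-thesis: assembly does not conclude the sub-problem Statement — note: D-0027 §2.1 audit (human 2026-08-15: routes that do not decide the summit are removed): the assembly concludes `SteadyNeg`, not the sub-problem statement; a NEW conforming route may be opened from the same idea (generated `closes : … → _root_.AnomalousDissipation`).. The file is kept as the record of this route; refuted decls are indexed as negative knowledge (`ledger negatives`).

# Route SteadySweep — AnomalousDissipation, negative side of the STEADY sub-line; realises idea card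
steady-states-cannot-sweep

## Thesis X (words)
It suffices to show X = SteadyNeg (item stmt-AnomalousDissipation-0222, shared with CoherentStates
#5 and Neg #4): for every smooth
divergence-free mean-zero steady force f on T³ and every family of steady classical Navier–Stokes
states (u_j, p_j) with ν_j → 0 and
∫|u_j|² ≤ E, the dissipation ν_j‖∇u_j‖² tends to 0. This route is an ALTERNATIVE DECOMPOSITION of
that shared statement (D-0019: a
separate route sharing the decl), split along the SWEEPING NUMBER S = |u|/v_η: the slow set {|u_j| <
λ} (crux SlowSetNoAnomaly) and the
fast set {|u_j| ≥ λ} (crux FastSetNoAnomaly), glued by an indicator split and a diagonal choice λ_j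
→ 0 (item Assembly, elementary).

## Thesis X (Lean, one line; = item SteadyNeg, verbatim the signature of stmt-0222, elaborated rc 0
in Sketch.lean)
∀ f, Torus.IsSmooth f → Torus.IsDivFree f → Torus.HasZeroMean f → ∀ ν u p, (∀ j, 0 < ν j) → Tendsto
ν atTop (nhds 0) →
(∀ j, Torus.IsClassicalNSSolutionOn Set.univ (ν j) (fun _ => f) (fun _ => u j) (fun _ => p j)) → (∃
E, ∀ j, ∫ ‖u j x‖² ≤ E) →
Tendsto (fun j => ν j * Torus.gradNormSq (u j)) atTop (nhds 0)
(all constants exist: Literature.Analysis.FunctionSpaces.Torus.{IsSmooth, IsDivFree, HasZeroMean,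
IsClassicalNSSolutionOn, gradNormSq, partialDeriv,
convect, laplacian, gradient}; Literature.Analysis.FluidPDE.IsClassicalNSSolutionOn for the planar
limit object.)

## Assembly (item Assembly): SlowSetNoAnomaly → FastSetNoAnomaly → EternalPlanarLiouville →
SteadyNeg
Glue only: ν_j gradNormSq(u_j) = ν_j∫_{|u_j|<λ}Σ‖∂_i u_j‖² + ν_j∫_{λ≤|u_j|}Σ‖∂_i u_j‖² (u_j smooth ⇒
integrable, the level set of a
continuous function is measurable); FastSetNoAnomaly kills the second term for every fixed λ > 0, a
diagonal sequence λ_j ↓ 0 keeps it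
killed, SlowSetNoAnomaly with that λ_j kills the first. EternalPlanarLiouville is carried as the
line's third crux (the rigidity input of
the fast-set programme); the glue does not use it. Summit-level meaning: SteadyNeg proved certifies
that UNSTEADINESS IS NECESSARY for the
zeroth law (kills CoherentStates' steady sub-line 0219, feeds Neg #4); it does not decide
AnomalousDissipation by itself, and says so.

## Mechanism (why this is a line of attack and not a restatement)
Steadiness breaks Galilean covariance. SweepIdentity (support, exact, pressure-free because the test
fields are divergence free):
∫⟨u,(a·∇)ψ⟩ + ∫⟨u−a,((u−a)·∇)ψ⟩ + ν∫⟨u,Δψ⟩ + ∫⟨f,ψ⟩ = 0 for every constant frame velocity a and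
smooth div-free ψ. With a = local
mean and ψ a div-free bump at scale r it says: the variation of u ALONG ITS OWN DIRECTION at scale
r, modulo gradients, is
O(v_r/|a| + ν/(|a|r) + r|f|/(|a|v_r)) relative to its size — a ν-uniform, rigorous Taylor
frozen-flow constraint (Frisch 1995 §5.1
(5.3)–(5.5): intensity I = v′/U = 1/S). On the fast set S → ∞ at the Kolmogorov scale, and the
blow-down of a steady state is NOT a
steady 2½-D flow but — writing τ = x_∥/S, the parabolised Navier–Stokes scaling (Hirsch 1988 §2.4) —
an ETERNAL planar Navier–Stokes
flow in Taylor time τ plus a passive streamwise scalar: ∂_τW⊥ + (W⊥·∇⊥)W⊥ + ∇⊥P = Δ⊥W⊥, ∂_τW₃ +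
W⊥·∇⊥W₃ = Δ⊥W₃. Rigidity of such
eternal planar flows is a THEOREM in the bounded case (KNSS 2009 Thm 5.1, PROVED in tree:
KNSS2009_liouville_planar_holds) and, for
steady planar flows, up to growth |y|^α, α < 1/3 (Bildhauer–Fuchs–Zhang 2012 Thm 1.5) — exactly
Kolmogorov's exponent. Crux
EternalPlanarLiouville asks for the eternal version with sublinear growth; crux FastSetNoAnomaly is
the full fast-set statement (its
future children: blow-down compactness along streamlines; the Liouville; exclusion of
affine/strained-layer limits, which energy and
enstrophy budgets alone do NOT exclude). On the slow set the level-set energy identity (support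
SlowSetEnergyIdentity) isolates the two
fluxes — pressure work and viscous influx — that crux SlowSetNoAnomaly must control; both novelty
audits of the card name this the real crux
(VWI/ECS put their wave Reynolds stress on the critical level u = c, c = 0 for lab-steady states:
Hall–Sherwin 2010).

Rationale: WHY THIS LINE. The steady negative crux SteadyNeg (0222) sits undecomposed in two routes; the only
a-priori fact is ν‖∇u‖² = (f,u) ≤ ‖f‖√E.
Card steady-states-cannot-sweep supplies a MECHANISM that uses steadiness of the SOLUTION (outside
Cheskidov's force-robust class):
without ∂_t the sweeping term (ū·∇)u cannot be absorbed, so small scales of a steady state are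
frozen along the local stream. Import
from ANOTHER AREA (NS regularity / blow-up technology): blow-downs + Liouville theorems for ancient
solutions (KochNadirashviliSereginSverak2009,
proved in tree; BildhauerFuchsZhang2012 Thm 1.5, growth α<1/3; FuchsZhong2011/Gilbarg–Weinberger),
with the explicit dictionary
"streamwise distance / local speed ↦ time" (Taylor1938; Tennekes1975; Frisch1995 §5.1; parabolised
NS, Hirsch1988 §2.4): the
blow-down of a steady state at a fast point is an ETERNAL PLANAR Navier–Stokes flow in Taylor time,
not a steady 2½-D flow (this
repairs the card's R2: the ghost force lim S∂₃W is dense in H⁻¹, the Taylor-time scaling removes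
it). Physical anchors of the trichotomy:
Burgers/Lundgren structures (Lundgren1982, MoffattKidaOhkitani1994) = frozen branch; VWI/ECS
critical layers (HallSherwin2010) = slow branch.
RANKED CRUXES. #2 SlowSetNoAnomaly (hardest, most informative; both card audits: "R4 is the real
crux"): for steady bounded-energy families
and thresholds λ_j → 0, ν_j∫_{|u_j|<λ_j}|∇u_j|² → 0. #3 FastSetNoAnomaly ("steady states cannot
sweep"): for every fixed λ>0,
ν_j∫_{|u_j|≥λ}|∇u_j|² → 0. #4 EternalPlanarLiouville: eternal classical planar NS with |W(t,y)| ≤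
C(1+|y|)^θ, θ<1 ⇒ W(t,·) constant
(θ=0 ancient bounded = KNSS Thm 5.1 proved; steady α<1/3 = BFZ Thm 1.5; K41 needs θ=1/3; FALSE at
θ=1 by the strained shear layer
W=(−γy₁, γy₂+V(y₁)), V″=Ce^{−γy₁²/2}). SUPPORT (provable now): SweepIdentity (exact, div-free tests,
any frame velocity a);
SlowSetEnergyIdentity (ν∫g(k)|∇u|² = ∫g(k)f·u + ∫p g′(k)u·∇k − ν∫g′(k)|∇k|², k=|u|²/2, any smooth
g); BoundedEternalPlanarRigidity (θ=0,
classical eternal, from KNSS2009_liouville_planar_holds); Assembly (indicator split + diagonal λ_j).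
Target SteadyNeg = 0222 verbatim.
KILL CRITERIA. Any steady bounded-energy family with inf_j ν_j‖∇u_j‖² > 0 (= SteadyZerothLaw 0219
proved) refutes the target and closes
the route; a refutation of #4 at some θ ≤ 1/3 voids the fast-set programme (close unless #3 has
another proof); a refutation of #3 alone
(anomaly on the fast set) refutes Taylor rigidity itself — close; #2 refuted with #3 proved pins
every steady witness to stagnation sets
(route converts into a design spec for 0219 and closes as superseded).
NOT DECOMPOSED YET (tenure, by glued splits ≤3 children): #3 into (i) blow-down
compactness/selection at fast dissipation points with
uniform bounds along the stream window, limits = eternal Taylor-time 2½-D flows; (ii) = #4 (+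
heat-Liouville for the passive W₃);
(iii) exclusion of affine/linear-growth limits (space-filling strained Burgers-layer stacks pass
energy AND enstrophy budgets — a
dynamical statement is needed). #2 into the pressure-flux and viscous-influx halves of
SlowSetEnergyIdentity. No definitions requested:
every notion exists (Torus calculus; FluidPDE.IsClassicalNSSolutionOn on EuclideanSpace ℝ (Fin 2)).
NOVELTY (full text in the Novelty field). Searched 2026-08-15: lit frontier/bridges (bridge =
NavierStokesRegularity: KNSS), crossref
("Liouville stationary Navier–Stokes plane growth", "Gilbarg Weinberger … Fuchs Zhong", BFZ read:
arXiv:1210.4018 pp.3–4), lit vsearch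
(Frisch p.43 Taylor hypothesis; Hirsch p.176 PNS), galaxy --star all "Taylor hypothesis" (no
relevant hit; panama queue down), searchd
rc 75 twice. Nearest prior art: the card's audited physics ancestry (Batchelor 1956, VWI Hall–Smith
1991/HallSherwin2010, Benney–Bergeron
1969) + KNSS2009/BFZ2012 Liouville theorems. Delta: Taylor-time blow-down of STEADY states onto
eternal planar NS + the slow/fast
split of 0222 with the level-set identity; BFZ's open optimal exponent meets K41's 1/3. Grade
(self): new-combination.
BARRIERS (full text in the Barriers field): Cheskidov2023_thm13 evaded by construction (uses
steadiness of the solution; scope caveat (a));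
AlexakisDoering2006 USED inside the planar limit; DEIJ2022 thm4 helps (passive W₃ advected by a
non-mixing eternal planar flow);
DeRosaDrivasInversi2024/DeRosaIsett2024 intermittency bounds constrain, not block, the fast-set
branch (iii); Marchioro consistent.

Novelty: NOVELTY (planner, route open 2026-08-15; searches run BEFORE this claim).
Searches: `lit frontier AnomalousDissipation --since 2020` (30 rows; nothing on steady states /
Liouville); `lit bridges AnomalousDissipation --cross any`
(bridge exploited here = NavierStokesRegularity roots: KNSS Liouville technology); `lit search
--source crossref` x4: "Liouville theorem stationary
Navier-Stokes plane growth" (Seregin 2016 doi:10.1088/0951-7715/29/8/2191, Chae–Wolf 2019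
doi:10.1007/s00526-019-1549-5, Tsai 2021
doi:10.1007/s42985-020-00056-6 — all 3-D D-solutions decaying at infinity, a different regime),
"…Bildhauer Fuchs Zhang" (doi:10.1007/s00021-012-0122-1
READ as arXiv:1210.4018 pp.3–4: Thm 1.5 steady planar NS with limsup|u||x|^{-α}<∞, α<1/3 ⇒ constant;
Rem 1.4 optimal α open), "Gilbarg Weinberger …
Fuchs Zhong" (doi:10.1007/s10958-011-0578-1); `lit vsearch` "large mean advection makes downstream
coordinate act as time … parabolized … Liouville"
(hits: book:frisch1995 p.43 = §5.1 (5.3)–(5.5) Taylor hypothesis, intensity I=v′/U; book:hirsch1988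
p.176 §2.4 Parabolized Navier–Stokes — a CFD
approximation for steady flows with a dominant direction, never a rigidity theorem); `lit galaxy
search "Taylor hypothesis" --star all` (12 pdf rows, all
experimental/irrelevant; panama queue down) and "Liouville theorem ancient solutions two-dimensional
Navier-Stokes" --star pdf (0); searchd rc 75 / reset
twice (recorded; openalex+arXiv HTTP 429). Plus the card's two refuter audits (Batchelor 1  [refs: 10.1088/0951-7715/29/8/2191, 10.1007/s00526-019-1549-5, 10.1007/s42985-020-00056-6, 10.1007/s00021-012-0122-1, 10.1007/s10958-011-0578-1, 10.1017/s0022112056000123, 10.1017/S0022112091002227, 10.1002/sapm1969483181, 10.1017/s0022112056000123., 1210.4018, doi:10.1088/0951-7715/29/8/2191, doi:10.1007/s00526-019-1549-5, doi:10.1007/s42985-020-00056-6, doi:10.1007/s00021-012-0122-1, doi:10.1007/s10958]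

Barriers (technique_class: steady sweep-rigidity liouville planar-reduction neg-route): BARRIERS (catalogue Literature/Barriers/AnomalousDissipation read 2026-08-15; technique_class:
steady sweep-rigidity liouville planar-reduction neg-route).
Literature.Barriers.AnomalousDissipation.Cheskidov2023_thm13_not_forceRobustNoAnomaly: APPLIES in
spirit to every proof of a no-anomaly statement (SteadyNeg, SlowSetNoAnomaly, FastSetNoAnomaly are
ZerothLawNeg-type conclusions) and is EVADED BY CONSTRUCTION: every step uses the steadiness of the
SOLUTION (SweepIdentity has no ∂_t term to absorb (a·∇)u; SlowSetEnergyIdentity is the steady local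
energy balance; the blow-down limit is eternal only because the state is steady) — scope caveat (a)
of the barrier ("says nothing against arguments using steadiness"); Cheskidov's refuting family is
time-periodic with sweeping-scale time dependence, exactly the freedom denied here. The identities
even tolerate ν-dependent smooth forces (only r‖f‖/(|a|v_r) and λ‖f‖_{L¹} enter), so they are not
L²-force-robust velocity-level energy estimates in the blocked class — they fail for unsteady flows
instead.
Literature.Barriers.AnomalousDissipation.AlexakisDoering2006_energyDissipationBound: USED, not
evaded — the Taylor-time limit object of the fast set is a planar Navier–Stokes flow, the class
where enstrophy-level rigidity (and KNSS's vorticity maximum principle) is available; the route's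
planar statements (EternalPlanarLiouville, BoundedEternalPlanarRigidity) are unforced whole-plane
Liouville theorems, so the barrier's forced-torus bound

History (route lifecycle, newest last):
- 2026-08-15T13:38:20Z · CLOSED retired — not-a-thesis: assembly does not conclude the sub-problem Statement (operator:999:1257524)

sub-problem: AnomalousDissipation · status: closed(retired) · opened planner-plancard-AnomalousDissipation-Anomalo-2c31d09f-0 2026-08-15T10:58:31Z · rev 1 · ledger route-AnomalousDissipation-SteadySweep
GENERATED by the gate from the ledger (D-0016/17). Provers cite these decls: `theorem foo : Summit.AnomalousDissipation.AnomalousDissipation.Theses.SteadySweep.<Decl> := …` in Summits/AnomalousDissipation/AnomalousDissipation/Theorems/<Name>.lean.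
-/

namespace Summit.AnomalousDissipation.AnomalousDissipation.Theses.SteadySweep

open scoped BigOperators Topology Manifold Classical MeasureTheory ProbabilityTheory Matrix InnerProductSpace ComplexConjugate ContinuousMap
open Filter Set Function TopologicalSpace MeasureTheory

attribute [summit_statement] _root_.AnomalousDissipation

open Literature.Turb

/-- item stmt-AnomalousDissipation-0222 · target · rank 0 · open · by planner
why it might fail: False iff some steady bounded-energy family keeps ν_j‖∇u_j‖² ≥ ε (= SteadyZerothLaw 0219, open both ways): in 3-D the only a-priori fact is ν‖∇u‖² = (f,u) ≤ ‖f‖√E; a frozen K41 hierarchy of strained Burgers layers is energetically admissible; only 2-D is rigid (Alexakis–Doering).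
sources: FoiasManleyRosaTemam2001, Cheskidov2023, BrueDeLellis2023, AlexakisDoering2006PLA, Literature.Barriers.AnomalousDissipation.Cheskidov2023_thm13_not_forceRobustNoAnomaly
Shared with route Neg (#4 there). -/
@[route_item "route-AnomalousDissipation-SteadySweep"]
def SteadyNeg : Prop :=
  ∀ f : UnitAddTorus (Fin 3) → EuclideanSpace ℝ (Fin 3), Literature.Analysis.FunctionSpaces.Torus.IsSmooth f → Literature.Analysis.FunctionSpaces.Torus.IsDivFree f → Literature.Analysis.FunctionSpaces.Torus.HasZeroMean f → ∀ (ν : ℕ → ℝ) (u : ℕ → UnitAddTorus (Fin 3) → EuclideanSpace ℝ (Fin 3)) (p : ℕ → UnitAddTorus (Fin 3) → ℝ), (∀ j, 0 < ν j) → Filter.Tendsto ν Filter.atTop (nhds 0) → (∀ j, Literature.Analysis.FunctionSpaces.Torus.IsClassicalNSSolutionOn Set.univ (ν j) (fun _ => f) (fun _ => u j) (fun _ => p j)) → (∃ E : ℝ, ∀ j, MeasureTheory.integral MeasureTheory.volume (fun x => ‖u j x‖ ^ 2) ≤ E) → Filter.Tendsto (fun j => ν j * Literature.Analysis.FunctionSpaces.Torus.gradNormSq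 (u j)) Filter.atTop (nhds 0)

/-- item stmt-AnomalousDissipation-1764 · crux · rank 2 · closed · moot by None · by planner
why it might fail: Must hold for arbitrarily slow l_j→0; the level-set balance leaves pressure work ∮_{|u|=l} p u·n and viscous influx uncontrolled by energy, and steady/TW coherent states carry their Reynolds stress on the critical level u=c=0 (HallSherwin2010): a witness dissipating inside a slow matrix breaks it.
sources: HallSherwin2010, doi:10.1017/S0022112091002227, FoiasManleyRosaTemam2001, Cheskidov2023, Literature.Barriers.AnomalousDissipation.Cheskidov2023_thm13_not_forceRobustNoAnomaly
[crux, rank 2 — branch (Z), 'the real crux' per both novelty audits of the card] For every smooth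
div-free mean-zero steady f, every steady classical family (u_j,p_j) with ν_j → 0 and ∫|u_j|² ≤ E,
and EVERY sequence of thresholds l_j > 0 with l_j → 0: ν_j ∫_{‖u_j‖ < l_j} Σ_i‖∂_i u_j‖² → 0 — the
slow (near-stagnant) set carries no anomalous dissipation. Tool: SlowSetEnergyIdentity with g ≈
1_{k<l²/2}: slow-set dissipation = O(l‖f‖_{L¹}) + pressure-work flux ∫ p g′(k) u·∇k + viscous influx
−ν∫g′(k)|∇k|² (≥ 0); the crux is that slow regions of STEADY states cannot import O(1) power through
these two fluxes. Equivalent form: lim_{l→0} limsup_j ν_j∫_{‖u_j‖<l}|∇u_j|² = 0. Sources: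
HallSherwin2010 (VWI: wave Reynolds stress lives in the critical layer u = c; c = 0 for lab-steady
states), doi:10.1017/S0022112091002227 (Hall–Smith 1991), FoiasManleyRosaTemam2001 (steady energy
identity), card steady-states-cannot-sweep R4. -/
@[route_item "route-AnomalousDissipation-SteadySweep"]
def SlowSetNoAnomaly : Prop :=
  ∀ f : UnitAddTorus (Fin 3) → EuclideanSpace ℝ (Fin 3), Literature.Analysis.FunctionSpaces.Torus.IsSmooth f → Literature.Analysis.FunctionSpaces.Torus.IsDivFree f → Literature.Analysis.FunctionSpaces.Torus.HasZeroMean f → ∀ (ν : ℕ → ℝ) (u : ℕ → UnitAddTorus (Fin 3) → EuclideanSpace ℝ (Fin 3)) (p : ℕ → UnitAddTorus (Fin 3) → ℝ), (∀ j, 0 < ν j) → Filter.Tendsto ν Filter.atTop (nhds 0) → (∀ j, Literature.Analysis.FunctionSpaces.Torus.IsClassicalNSSolutionOn Set.univ (ν j) (fun _ => f) (fun _ => u j) (fun _ => p j)) → (∃ E : ℝ, ∀ j, MeasureTheory.integral MeasureTheory.volume (fun x => ‖u j x‖ ^ 2) ≤ E) → ∀ l : ℕ → ℝ, (∀ j,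 0 < l j) → Filter.Tendsto l Filter.atTop (nhds 0) → Filter.Tendsto (fun j => ν j * MeasureTheory.integral (MeasureTheory.volume.restrict {x | ‖u j x‖ < l j}) (fun x => ∑ i, ‖Literature.Analysis.FunctionSpaces.Torus.partialDeriv i (u j) x‖ ^ 2)) Filter.atTop (nhds 0)

/-- item stmt-AnomalousDissipation-1765 · crux · rank 3 · closed · moot by None · by planner
why it might fail: Freezing needs S=|u|/δu_η→∞, false for O(1)-jump layers: space-filling stacks of strained Burgers layers (width and spacing ~√ν, |∇u|~ν^{-1/2}) pass energy AND enstrophy budgets; blow-down compactness needs stream-uniform bounds, and limits may grow linearly (θ=1) where planar rigidity fails.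
sources: Taylor1938, Tennekes1975, Lundgren1982, MoffattKidaOhkitani1994, KochNadirashviliSereginSverak2009, BildhauerFuchsZhang2012
[crux, rank 3 — branches (F)+(O): 'steady states cannot sweep'] Same hypotheses; for every FIXED l >
0: ν_j ∫_{l ≤ ‖u_j‖} Σ_i‖∂_i u_j‖² → 0 — where the fluid moves at speed ≥ l the sweeping number S =
|u|/v_η ≥ l/(εν)^{1/4} → ∞, SweepIdentity freezes the dissipative structures along u, and frozen
structures cannot dissipate O(1) in total. Programme (future glued split, ≤ 3 children): (i)
blow-down compactness at fast dissipation points with uniform local bounds along a stream window of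
physical length ℓ, Uη/v ≪ ℓ ≪ 1: limits are ETERNAL planar Navier–Stokes flows in Taylor time τ =
x_∥/S plus a passive streamwise scalar (parabolised NS scaling: S∂₃W + W·∇W + ∇P = ΔW, τ = y₃/S ⇒
∂_τW⊥ + W⊥·∇⊥W⊥ + ∇⊥P = Δ⊥W⊥); (ii) rigidity of the limit = EternalPlanarLiouville (+ heat-Liouville
for W₃), θ = 0 case proved in tree (KNSS Thm 5.1); (iii) exclusion of affine / linear-growth limits
= strained Burgers-layer stacks at spacing √ν, which pass energy AND enstrophy budgets (dynamical
input needed). Sources: Taylor1938; Tennekes1975 (Eulerian time scale = sweeping U/η); Frisch1995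
§5.1 (5.3)–(5.5); Lundgren1982, MoffattKidaOhkitani1994 (strained Burgers structures = the frozen
branch); KochNadir -/
@[route_item "route-AnomalousDissipation-SteadySweep"]
def FastSetNoAnomaly : Prop :=
  ∀ f : UnitAddTorus (Fin 3) → EuclideanSpace ℝ (Fin 3), Literature.Analysis.FunctionSpaces.Torus.IsSmooth f → Literature.Analysis.FunctionSpaces.Torus.IsDivFree f → Literature.Analysis.FunctionSpaces.Torus.HasZeroMean f → ∀ (ν : ℕ → ℝ) (u : ℕ → UnitAddTorus (Fin 3) → EuclideanSpace ℝ (Fin 3)) (p : ℕ → UnitAddTorus (Fin 3) → ℝ), (∀ j, 0 < ν j) → Filter.Tendsto ν Filter.atTop (nhds 0) → (∀ j, Literature.Analysis.FunctionSpaces.Torus.IsClassicalNSSolutionOn Set.univ (ν j) (fun _ => f) (fun _ => u j) (fun _ => p j)) → (∃ E : ℝ, ∀ j, MeasureTheory.integral MeasureTheory.volume (fun x => ‖u j x‖ ^ 2) ≤ E) → ∀ l : ℝ, 0 < l → Filter.Tendsto (fun j => ν j * MeasureTheory.integral (MeasureTheory.volume.restrict {x | l ≤ ‖u j x‖}) (fun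 x => ∑ i, ‖Literature.Analysis.FunctionSpaces.Torus.partialDeriv i (u j) x‖ ^ 2)) Filter.atTop (nhds 0)

/-- item stmt-AnomalousDissipation-1766 · crux · rank 4 · closed · moot by None · by planner
why it might fail: False at θ=1 (strained shear layer W=(−γy₁,γy₂+V(y₁)), V″=Ce^{−γy₁²/2}); known only for θ=0 bounded ancient (KNSS Thm 5.1) and STEADY growth α<1/3 (BFZ2012 Thm 1.5, optimal α open, Rem 1.4); for θ>0 the drift leaves BMO⁻¹; a time-periodic/self-similar planar flow with growth in [1/3,1) refutes it.
sources: BildhauerFuchsZhang2012, arXiv:1210.4018, KochNadirashviliSereginSverak2009, FuchsZhong2011, Literature.Analysis.FluidPDE.KNSS2009_liouville_planar_holds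
[crux, rank 4 — rigidity of the Taylor-time limit object; generalises a PROVED cone fact] Every
ETERNAL classical solution (W,P) of unforced planar Navier–Stokes with unit viscosity on ℝ × ℝ²
(Literature.Analysis.FluidPDE.IsClassicalNSSolutionOn Set.univ 1 0 W P) whose velocity grows
sublinearly, ‖W t y‖ ≤ C(1+‖y‖)^θ with θ < 1 uniformly in t, is spatially constant: W t y = W t 0
(the parasitic solutions b(t) remain, as in KNSS). Known: θ = 0 and ancient, for bounded WEAK
solutions — KNSS 2009 Thm 5.1, PROVED in tree
(Literature.Analysis.FluidPDE.KNSS2009_liouville_planar_holds; support item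
BoundedEternalPlanarRigidity is its classical-eternal corollary); STEADY planar flows with
limsup|u||x|^{-α} < ∞, α < 1/3 — BildhauerFuchsZhang2012 Thm 1.5 (optimal α open, Rem 1.4; finite
Dirichlet integral: Gilbarg–Weinberger, FuchsZhong2011). Kolmogorov scaling of a blow-down gives
exactly θ = 1/3, so the route needs the time-dependent statement at or above BFZ's threshold; any θ₀
> 1/3 version is already decisive, θ < 1 is the natural conjecture. Sharpness: FALSE at θ = 1 — W =
(−γy₁, γy₂ + V(y₁)) with V″ = C e^{−γy₁²/2} (hyperbolic strain + viscously smoothed shear layer) is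
a steady plana -/
@[route_item "route-AnomalousDissipation-SteadySweep"]
def EternalPlanarLiouville : Prop :=
  ∀ (W : ℝ → EuclideanSpace ℝ (Fin 2) → EuclideanSpace ℝ (Fin 2)) (P : ℝ → EuclideanSpace ℝ (Fin 2) → ℝ), Literature.Analysis.FluidPDE.IsClassicalNSSolutionOn Set.univ 1 (fun _ _ => 0) W P → (∃ C θ : ℝ, θ < 1 ∧ ∀ t y, ‖W t y‖ ≤ C * (1 + ‖y‖) ^ θ) → ∀ t y, W t y = W t 0

/-- item stmt-AnomalousDissipation-1767 · support · rank 9 · closed · moot by None · by planner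
sources: Taylor1938, Tennekes1975, Frisch1995, DoeringFoias2002
[support — provable now; the mechanism in Lean] For a steady classical NS state (ν,f,u,p) on T³
(Torus.IsClassicalNSSolutionOn univ ν (fun _ => f) (fun _ => u) (fun _ => p)), every constant frame
velocity a ∈ ℝ³ and every smooth divergence-free test field ψ: ∫⟨u,(a·∇)ψ⟩ + ∫⟨u−a,((u−a)·∇)ψ⟩ +
ν∫⟨u,Δψ⟩ + ∫⟨f,ψ⟩ = 0. Derivation: pair (u·∇)u + ∇p = νΔu + f with ψ; pressure drops (div ψ = 0);
∫⟨(u·∇)u,ψ⟩ = −∫⟨u,(u·∇)ψ⟩ (IBP on the torus, div u = 0); split (u·∇)ψ = (a·∇)ψ + ((u−a)·∇)ψ and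
note ∫⟨a,((u−a)·∇)ψ⟩ = −Σ_i a_i∫ψ_i div(u−a) = 0. CONTENT (not part of the statement): with a =
local mean on B_r(x₀) and ψ a normalised div-free bump at scale r, the streamwise variation of u at
scale r modulo gradients is ≤ v_r² r² + ν v_r r + r³‖f‖_∞, i.e. of relative size ≤ 1/S + ν/(|a|r) +
r‖f‖_∞/(|a|v_r), S = |a|/v_r — Taylor's frozen-flow hypothesis as a ν-uniform constraint on STEADY
states (the velocity form with general tests is false because of the harmonic local pressure —
refuter audit of the card; div-free tests, equivalently the curl form, fix this). Needs the torus
IBP facts Torus.integral_partialDeriv_eq_zero etc. (TorusCalculus). Sources: Taylor1938;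
Tennekes1975; Frisch1995 §5.1; Doer -/
@[route_item "route-AnomalousDissipation-SteadySweep"]
def SweepIdentity : Prop :=
  ∀ (ν : ℝ) (f u : UnitAddTorus (Fin 3) → EuclideanSpace ℝ (Fin 3)) (p : UnitAddTorus (Fin 3) → ℝ), Literature.Analysis.FunctionSpaces.Torus.IsClassicalNSSolutionOn Set.univ ν (fun _ => f) (fun _ => u) (fun _ => p) → ∀ (a : EuclideanSpace ℝ (Fin 3)) (ψ : UnitAddTorus (Fin 3) → EuclideanSpace ℝ (Fin 3)), Literature.Analysis.FunctionSpaces.Torus.IsSmooth ψ → Literature.Analysis.FunctionSpaces.Torus.IsDivFree ψ → MeasureTheory.integral MeasureTheory.volume (fun x => inner ℝ (u x) (Literature.Analysis.FunctionSpaces.Torus.convect (fun _ => a) ψ x)) + MeasureTheory.integral MeasureTheory.volume (fun x => inner ℝ (u x - a) (Literature.Analysis.FunctionSpaces.Torus.convect (fun y => u y - a) ψ x)) + ν * MeasureTheory.integral MeasureTheory.volume (fun x => inner ℝ (u x) (Literature.Analysis.FunctionSpaces.Torus.laplacian ψ x)) + MeasureTheory.integral MeasureTheory.volume (fun x => inner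 ℝ (f x) (ψ x)) = 0

/-- item stmt-AnomalousDissipation-1768 · support · rank 9 · closed · moot by None · by planner
sources: FoiasManleyRosaTemam2001, DoeringFoias2002, HallSherwin2010
[support — provable now; the tool for crux #2] For a steady classical NS state (ν,f,u,p) on T³ and
every smooth g : ℝ → ℝ, with k(x) = ‖u x‖²/2: ν∫ g(k)Σ_i‖∂_i u‖² = ∫ g(k)⟨f,u⟩ + ∫ p·g′(k)·⟨u,∇k⟩ −
ν∫ g′(k)‖∇k‖². Derivation: dot (u·∇)u + ∇p = νΔu + f with g(k)u and integrate: ∫g(k)⟨(u·∇)u,u⟩ =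
∫u·∇G(k) = 0 (G′ = g, div u = 0); ∫g(k)⟨∇p,u⟩ = −∫p div(g(k)u) = −∫p g′(k)⟨u,∇k⟩; ν∫g(k)⟨Δu,u⟩ =
−ν∫g(k)|∇u|² − ν∫g′(k)|∇k|² (Σ_i u_i∂_ju_i = ∂_jk). With g decreasing from 1 to 0 across k = l²/2
this is the smooth co-area form of the slow-set balance ν∫_{|u|<l}|∇u|² = ∫_{|u|<l} f·u − ∮_{|u|=l}
p u·n + νl∮_{|u|=l}|∇|u||: the last term (viscous influx of kinetic energy into slow fluid) is ≥ 0
and the pressure-work flux is the VWI critical-layer channel. Sources: FoiasManleyRosaTemam2001 Ch.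
II (energy identities); DoeringFoias2002 §2; HallSherwin2010. -/
@[route_item "route-AnomalousDissipation-SteadySweep"]
def SlowSetEnergyIdentity : Prop :=
  ∀ (ν : ℝ) (f u : UnitAddTorus (Fin 3) → EuclideanSpace ℝ (Fin 3)) (p : UnitAddTorus (Fin 3) → ℝ), Literature.Analysis.FunctionSpaces.Torus.IsClassicalNSSolutionOn Set.univ ν (fun _ => f) (fun _ => u) (fun _ => p) → ∀ g : ℝ → ℝ, ContDiff ℝ (⊤ : ℕ∞) g → ν * MeasureTheory.integral MeasureTheory.volume (fun x => g (‖u x‖ ^ 2 / 2) * ∑ i, ‖Literature.Analysis.FunctionSpaces.Torus.partialDeriv i u x‖ ^ 2) = MeasureTheory.integral MeasureTheory.volume (fun x => g (‖u x‖ ^ 2 / 2) * inner ℝ (f x) (u x)) + MeasureTheory.integral MeasureTheory.volume (fun x => p x * deriv g (‖u x‖ ^ 2 / 2) * inner ℝ (u x) (Literature.Analysis.FunctionSpaces.Torus.gradient (fun y => ‖u y‖ ^ 2 / 2) x)) - ν * MeasureTheory.integral MeasureTheory.volume (fun x => deriv g (‖u x‖ ^ 2 / 2) * ‖Literature.Analysis.FunctionSpaces.Torus.gradient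 (fun y => ‖u y‖ ^ 2 / 2) x‖ ^ 2)

/-- item stmt-AnomalousDissipation-1769 · support · rank 9 · closed · moot by None · by planner
sources: KochNadirashviliSereginSverak2009, Literature.Analysis.FluidPDE.KNSS2009_liouville_planar_holds
[support — provable now] The θ = 0 case of EternalPlanarLiouville: a bounded eternal classical
planar NS solution (unit viscosity, no force) is spatially constant, W t y = W t 0 for all t, y.
Proof map (~150–250 lines): a bounded classical solution on ℝ × ℝ² restricted to t < T is, after the
time shift t ↦ t − T, a bounded weak solution on ℝ² × (−∞,0) in the sense of
Literature.Analysis.FluidPDE.IsBoundedWeakNSSolutionOn (classical ⇒ weak: pair with a compactly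
supported div-free test field and integrate by parts); apply the PROVED fact
Literature.Analysis.FluidPDE.KNSS2009_liouville_planar_holds to get W t = b t a.e. in y for a.e. t <
T; continuity of W upgrades a.e. to everywhere; T arbitrary. Sources:
KochNadirashviliSereginSverak2009 Thm 5.1 (arXiv:0709.3599 p.9); in-tree
KNSSLiouvillePlanarHolds.lean. -/
@[route_item "route-AnomalousDissipation-SteadySweep"]
def BoundedEternalPlanarRigidity : Prop :=
  ∀ (W : ℝ → EuclideanSpace ℝ (Fin 2) → EuclideanSpace ℝ (Fin 2)) (P : ℝ → EuclideanSpace ℝ (Fin 2) → ℝ), Literature.Analysis.FluidPDE.IsClassicalNSSolutionOn Set.univ 1 (fun _ _ => 0) W P → (∃ C : ℝ, ∀ t y, ‖W t y‖ ≤ C) → ∀ t y, W t y = W t 0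

/-- item stmt-AnomalousDissipation-1763 · assembly · rank 1 · closed · moot by None · by planner
sources: DoeringFoias2002
[assembly — glue, provable now, ~150 lines] SlowSetNoAnomaly → FastSetNoAnomaly →
EternalPlanarLiouville → SteadyNeg. Proof: fix f, ν, u, p, E as in SteadyNeg. For l > 0 and each j,
gradNormSq (u j) = ∫_{‖u j‖<l}Σ‖∂_i u j‖² + ∫_{l≤‖u j‖}Σ‖∂_i u j‖²
(MeasureTheory.integral_add_compl: {‖u j x‖ < l} is measurable since u j is continuous
(IsSmoothSpaceTimeOn ⇒ smooth slice), the integrand is continuous hence integrable on the compact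
torus). FastSetNoAnomaly: b_j(l) := ν_j∫_{l≤‖u_j‖} → 0 for every fixed l > 0; choose N_1 < N_2 < …
with b_j(1/m) < 1/m for j ≥ N_m and put l_j := 1/m on [N_m, N_{m+1}) (l_j := 1 before N_1): l_j > 0,
l_j → 0, b_j(l_j) → 0. SlowSetNoAnomaly with this l gives a_j := ν_j∫_{‖u_j‖<l_j} → 0; sum → 0. The
third hypothesis (EternalPlanarLiouville) is carried, not used: it is the rigidity input of
FastSetNoAnomaly's programme, listed so that the route's line is the conjunction of its three
cruxes. Summit-level meaning: SteadyNeg = Neg #4; it certifies that unsteadiness is necessary for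
Literature.Turb.ZerothLaw and does not by itself decide AnomalousDissipation. -/
@[route_item "route-AnomalousDissipation-SteadySweep"]
def Assembly : Prop :=
  SlowSetNoAnomaly → FastSetNoAnomaly → EternalPlanarLiouville → SteadyNeg

end Summit.AnomalousDissipation.AnomalousDissipation.Theses.SteadySweep
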